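import Summits.Ventures.PercRepro.Night2NonFatOneHyp

/-!
# night-2: the NON-FAT case of (FAIR) — the level-1 income by the INCIDENCE PROFILE of `W` (gen 37)

Let `k_y` be the number of active faces whose hyperplane contains `y ∈ W` (`k_y ≤ 3`: four basis hyperplanes meet in a basis
point).  For `N ≥ 7` the level-1 bounds of `Night2NonFatOneHyp` give, uniformly in `y`,
`vCap (Q ∪ {y}) ≥ 11/18 − k_y · 7/30` and `faceSum (Q ∪ {y}) ≤ (2/9) · (Σ_y k_y)/(N − 2) + 20/9` (the chord bound on the faces of
`Q`, `Σ_{w active} t_w = Σ_y k_y`), so the level-1 income is at least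
**`Σ_y (11/18 − k_y · 7/30)⁺ / ((2/9) · (Σ_y k_y)/(N − 2) + 20/9)`** (`level_one_sum_ge_of_profile`) and the pair is fair whenever
this is `≥ 1` (`basis_pair_fair_of_profile`).  With `p_k = #{y : k_y = k}`: numerator `(11/18) p₀ + (17/45) p₁ + (13/90) p₂`,
denominator `(2/9)(p₁ + 2 p₂ + 3 p₃)/(N − 2) + 20/9` — the points of `W` on basis lines (`k_y = 3`) only cost.
Paper: proofs/NIGHT-2-g37.md §5.
-/

namespace PercRepro.Shadow

open PercRepro.ThmH PercRepro.PerFlat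

variable {α : Type*} [DecidableEq α] {M : Matroid α} [M.Finite] {G : Finset α}

open scoped Classical in
/-- The number of active faces whose hyperplane contains `y`. -/
noncomputable def incid (M : Matroid α) [M.Finite] (G B : Finset α) (z y : α) : ℕ :=
  (((insert z B \ coloops M G).filter (fun w => faceOk M G (insert z B) w)).filter
    (fun w => y ∈ clF M ((insert z B).erase w))).card

/-- Double counting: `Σ_{w active} t_w = Σ_{y ∈ W} k_y`. -/
theorem sum_card_filter_eq_sum_incid {B : Finset α} {z : α} :
    ∑ w ∈ (insert z B \ coloops M G).filter (fun w => faceOk M G (insert z B) w),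
      ((G \ insert z B).filter (fun y => y ∈ clF M ((insert z B).erase w))).card =
    ∑ y ∈ G \ insert z B, incid M G B z y := by
  unfold incid
  calc ∑ w ∈ (insert z B \ coloops M G).filter (fun w => faceOk M G (insert z B) w),
        ((G \ insert z B).filter (fun y => y ∈ clF M ((insert z B).erase w))).card
      = ∑ w ∈ (insert z B \ coloops M G).filter (fun w => faceOk M G (insert z B) w),
          ∑ y ∈ G \ insert z B, (if y ∈ clF M ((insert z B).erase w) then 1 else 0) := by
        apply Finset.sum_congr rfl
        intro w _
        rw [Finset.card_filter]
    _ = ∑ y ∈ G \ insert z B, ∑ w ∈ (insert z B \ coloops M G).filter (fun w => faceOk M G (insert z B) w),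
          (if y ∈ clF M ((insert z B).erase w) then 1 else 0) := Finset.sum_comm
    _ = _ := by
        apply Finset.sum_congr rfl
        intro y _
        rw [Finset.card_filter]

/-- **The level-1 income by the incidence profile** (`N ≥ 7`). -/
theorem level_one_sum_ge_of_profile (hG : G ∈ flatsQ M (5 + 1)) (hd : (gr M \ G).card = 2)
    (hk : kColoops M G = 1) (hs : ∀ e ∈ gr M, ∀ f ∈ gr M, e ≠ f → rkN M {e, f} = 2)
    (hl : ∀ e ∈ gr M, M.Indep {e}) (hnf : fatClosures M 5 G 2 = ∅) {B : Finset α}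
    (hB : B ∈ thinMembers M 5 G) (hnP : ¬ bigP M G B) {z : α} (hz : z ∈ G \ clF M B)
    (hl0 : loss M 5 G B z ≠ 0) (hN : 7 ≤ (G \ insert z B).card) :
    (∑ y ∈ G \ insert z B, max 0 (11 / 18 - (incid M G B z y : ℚ) * (7 / 30))) /
      (2 / 9 * ((∑ y ∈ G \ insert z B, (incid M G B z y : ℚ)) / (((G \ insert z B).card : ℚ) - 2)) + 2 / 9 * 10) ≤
    ∑ y ∈ G \ insert z B, vCap M G (insert y (insert z B)) / faceSum M G (insert y (insert z B)) := by
  have hd' : (gr M \ G).card ≤ 5 := by omega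
  set N : ℕ := (G \ insert z B).card with hNdef
  set A : Finset α := (insert z B \ coloops M G).filter (fun w => faceOk M G (insert z B) w) with hAdef
  have hNq : (7 : ℚ) ≤ (N : ℚ) := by exact_mod_cast hN
  have hN2 : (0 : ℚ) < (N : ℚ) - 2 := by linarith
  set S : ℚ := ∑ y ∈ G \ insert z B, (incid M G B z y : ℚ) with hSdef
  have hS0 : 0 ≤ S := Finset.sum_nonneg (fun y _ => by positivity)
  set D : ℚ := 2 / 9 * (S / ((N : ℚ) - 2)) + 2 / 9 * 10 with hDdef
  have hDpos : 0 < D := by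
    rw [hDdef]
    have : 0 ≤ S / ((N : ℚ) - 2) := div_nonneg hS0 hN2.le
    linarith
  -- the uniform face-sum bound
  have hsumt : ∑ w ∈ A, (((G \ insert z B).filter (fun y => y ∈ clF M ((insert z B).erase w))).card : ℚ) = S := by
    rw [hSdef, hAdef]
    exact_mod_cast sum_card_filter_eq_sum_incid
  have hface : ∀ y ∈ G \ insert z B, faceSum M G (insert y (insert z B)) ≤ D := by
    intro y hy
    refine le_trans (faceSum_insert_le hG hd hk hnf hB hnP hz hy) ?_
    rw [hDdef]
    apply add_le_add
    · have hterm' : ∀ w ∈ A, phiFace M ((insert z B).erase w) *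
          (((insert y (insert z B) \ coloops M G) \ clF M ((insert z B).erase w)).card : ℚ) ≤
          2 * (1 / 9 * ((((G \ insert z B).filter (fun y => y ∈ clF M ((insert z B).erase w))).card : ℚ) /
            ((N : ℚ) - 2))) := by
        intro w hw
        rw [hAdef, Finset.mem_filter] at hw
        have ht := card_filter_clF_erase_le hG hd hk hnf hB hnP hz hw.1 hw.2
        have hm := card_sdiff_clF_erase_ge hG hd hk hB hnP hz hw.1
        have hphi : phiFace M ((insert z B).erase w) ≤
            phiM (N + 1 - ((G \ insert z B).filter (fun y => y ∈ clF M ((insert z B).erase w))).card) :=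
          phiFace_le_of_le hG hd hw.2.1 (by omega)
        have hchord := phiM_le_chord hN ht
        have hc := card_sdiff_clF_erase_le_two hG hB hz y (Finset.mem_sdiff.1 hw.1).1
        have hc' : (((insert y (insert z B) \ coloops M G) \ clF M ((insert z B).erase w)).card : ℚ) ≤ 2 := by
          have : ((insert y (insert z B) \ coloops M G) \ clF M ((insert z B).erase w)).card ≤ 2 := by
            refine le_trans hc ?_
            split_ifs <;> norm_num
          exact_mod_cast this
        have hnn : (0 : ℚ) ≤ 1 / 9 * ((((G \ insert z B).filter (fun y => y ∈ clF M ((insert z B).erase w))).card : ℚ) /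
            ((N : ℚ) - 2)) := by positivity
        calc phiFace M ((insert z B).erase w) *
              (((insert y (insert z B) \ coloops M G) \ clF M ((insert z B).erase w)).card : ℚ)
            ≤ (1 / 9 * ((((G \ insert z B).filter (fun y => y ∈ clF M ((insert z B).erase w))).card : ℚ) /
                ((N : ℚ) - 2))) * 2 := by
              apply mul_le_mul _ hc' (by positivity) hnn
              refine le_trans hphi ?_
              rw [mul_div_assoc] at hchord
              exact hchord
          _ = 2 * (1 / 9 * ((((G \ insert z B).filter (fun y => y ∈ clF M ((insert z B).erase w))).card : ℚ) /
                ((N : ℚ) - 2))) := by ring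
      calc ∑ w ∈ A, phiFace M ((insert z B).erase w) *
            (((insert y (insert z B) \ coloops M G) \ clF M ((insert z B).erase w)).card : ℚ)
          ≤ ∑ w ∈ A, 2 * (1 / 9 * ((((G \ insert z B).filter (fun y => y ∈ clF M ((insert z B).erase w))).card : ℚ) /
              ((N : ℚ) - 2))) := Finset.sum_le_sum hterm'
        _ = 2 / 9 * (∑ w ∈ A, (((G \ insert z B).filter (fun y => y ∈ clF M ((insert z B).erase w))).card : ℚ)) /
              ((N : ℚ) - 2) := by
            rw [Finset.mul_sum, Finset.sum_div]
            apply Finset.sum_congr rfl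
            intro w _
            ring
        _ = 2 / 9 * (S / ((N : ℚ) - 2)) := by rw [hsumt]; ring
    · apply mul_le_mul_of_nonneg_left _ (by norm_num)
      exact_mod_cast card_facesIn_mem_le_ten hG hd hk hB hnP hz hy
  -- the per-point capacity
  have hcap : ∀ y ∈ G \ insert z B, max 0 (11 / 18 - (incid M G B z y : ℚ) * (7 / 30)) ≤
      vCap M G (insert y (insert z B)) := by
    intro y hy
    apply max_le (vCap_nonneg _)
    have hv := vCap_insert_ge hG hd hk hs hl hB hnP hz hy
    have hL1 : ∑ w ∈ (insert z B \ coloops M G).filter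
        (fun w => faceOk M G (insert z B) w ∧ y ∈ clF M ((insert z B).erase w)), req M 5 ((insert z B).erase w) ≤
        (incid M G B z y : ℚ) * (7 / 30) := by
      unfold incid
      have hfilt : (insert z B \ coloops M G).filter
          (fun w => faceOk M G (insert z B) w ∧ y ∈ clF M ((insert z B).erase w)) =
          ((insert z B \ coloops M G).filter (fun w => faceOk M G (insert z B) w)).filter
            (fun w => y ∈ clF M ((insert z B).erase w)) := by
        rw [Finset.filter_filter]
      rw [hfilt]
      calc ∑ w ∈ ((insert z B \ coloops M G).filter (fun w => faceOk M G (insert z B) w)).filter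
            (fun w => y ∈ clF M ((insert z B).erase w)), req M 5 ((insert z B).erase w)
          ≤ ∑ _w ∈ ((insert z B \ coloops M G).filter (fun w => faceOk M G (insert z B) w)).filter
            (fun w => y ∈ clF M ((insert z B).erase w)), (7 / 30 : ℚ) := by
            apply Finset.sum_le_sum
            intro w hw
            rw [Finset.mem_filter, Finset.mem_filter] at hw
            exact req_le_of_nonfat hG hd hnf hw.1.2.1
        _ = _ := by rw [Finset.sum_const, nsmul_eq_mul]
    linarith
  -- assemble
  rw [Finset.sum_div]
  apply Finset.sum_le_sum
  intro y hy
  have hpos := faceSum_pos_of_mem_tgtSets hG hd hk hB hnP hz hl0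
    (level_one_targets_subset hG hB hz (Finset.mem_image.2 ⟨y, hy, rfl⟩))
  rw [div_le_div_iff₀ hDpos hpos]
  have h1 := hcap y hy
  have h2 := hface y hy
  have h3 : 0 ≤ max 0 (11 / 18 - (incid M G B z y : ℚ) * (7 / 30)) := le_max_left _ _
  nlinarith [vCap_nonneg (M := M) (G := G) (insert y (insert z B))]

/-- **The fair share from the incidence profile** (`N ≥ 7`). -/
theorem basis_pair_fair_of_profile (hG : G ∈ flatsQ M (5 + 1)) (hd : (gr M \ G).card = 2)
    (hk : kColoops M G = 1) (hs : ∀ e ∈ gr M, ∀ f ∈ gr M, e ≠ f → rkN M {e, f} = 2)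
    (hl : ∀ e ∈ gr M, M.Indep {e}) (hnf : fatClosures M 5 G 2 = ∅) {B : Finset α}
    (hB : B ∈ thinMembers M 5 G) (hnP : ¬ bigP M G B) {z : α} (hz : z ∈ G \ clF M B)
    (hl0 : loss M 5 G B z ≠ 0) (hN : 7 ≤ (G \ insert z B).card)
    (hprof : 1 ≤ (∑ y ∈ G \ insert z B, max 0 (11 / 18 - (incid M G B z y : ℚ) * (7 / 30))) /
      (2 / 9 * ((∑ y ∈ G \ insert z B, (incid M G B z y : ℚ)) / (((G \ insert z B).card : ℚ) - 2)) + 2 / 9 * 10)) :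
    loss M 5 G B z ≤ rhoL M 5 G B z * lossIncomeH M 5 G (bigP M G) (dshGT2 M 5 G) B z := by
  have hfat : (fatClosures M 5 G 2).card ≤ 1 := by
    rw [hnf, Finset.card_empty]
    exact zero_le_one
  apply basis_pair_fair_of_level_one_sum hG hd hk hs hl hfat hB hnP hz hl0
  exact le_trans hprof (level_one_sum_ge_of_profile hG hd hk hs hl hnf hB hnP hz hl0 hN)

end PercRepro.Shadow
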